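import Literature.MathematicalPhysics.QuantumLattice.GrassmannLaplacian
import Literature.MathematicalPhysics.QuantumLattice.GrassmannIntegralPartial
import Literature.RingTheory.PowerSeries.NilpotentExpLog
import HarnessLib

/-!
# The Wilsonian effective action on a finite Grassmann algebra and its semigroup property

Topic `MathematicalPhysics/QuantumLattice`; generic layer (part 2) under the definition request
`defn-hubbardEffectiveAction` (route HubbardSuperconductivity/AposterioriCapRg, cruxes
CapRgScaleData / AposterioriOrderCriterion).  For a covariance `C` on the finite label set `Γ`
and an interaction `V` in the Grassmann algebra `𝒜 = GrassmannAlgebra R Γ`, Wilson's effective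
action is `𝒢 = -log ∫ dμ_C(χ) e^{-V(χ+ψ)}` (Salmhofer 1999, Def. 2.19 (2.102) and, for fermions,
§4.2.5 (4.72), §4.3.1 (4.85); Salmhofer 1998, §3.1).  With the Gaussian convolution
`μ_C ⋆ = e^{Δ_C}` of `GrassmannLaplacian.lean` (Salmhofer's Prop. 4.3, (4.88)) this file defines

* `constPart R : 𝒜 →ₐ[R] R` — the constant (field-independent) part (Mathlib's
  `ExteriorAlgebra.algebraMapInv`; `constPart_eq_coord_empty`: it is the coefficient of the empty
  monomial), the Gaussian expectation `gaussExpect R C = constPart ∘ μ_C ⋆` (`∫ dμ_C F`), and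
  **nilpotency of field polynomials without constant part** (`isNilpotent_of_constPart_eq_zero`);
* `grassmannLog1p R x = Σ_{k≥1} (-1)^{k+1} x^k / k` — the (truncated) logarithm of `1 + x`, with
  `grassmannExp_grassmannLog1p` / `grassmannLog1p_grassmannExp_sub_one` (the `exp`/`log` inverse
  pair on nilpotents, from `Literature.RingTheory.PowerSeries.NilpotentLog.exp_logSum`);
* `effBoltzmann R C V = μ_C ⋆ e^{-V}` (the effective Boltzmann factor `e^{𝒢(t,ψ)}` of (4.88), in
  the sign convention `𝒢(0) = -V`), `effPartitionFn R C V = ∫ dμ_C e^{-V}` (its constant part,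
  the normalised partition function `Z`), and the **effective action**
  `effAction R C V = -log (Z⁻¹ · μ_C ⋆ e^{-V})`, normalised to vanishing constant part as in
  Benfatto–Giuliani–Mastropietro 2006, (2.13) (`𝒱^{(0)}(0) = 0`, the constant `e^{-βL²F₀}` split
  off); Salmhofer's `𝒢(t,ψ)` of (4.85) (initial condition `λV = -V` here) is
  `log Z - effAction` (`effBoltzmann_eq_smul_grassmannExp`);
* the **semigroup property**: `effBoltzmann_add` — `μ_{C₁+C₂} ⋆ e^{-V} = μ_{C₁} ⋆ (μ_{C₂} ⋆ e^{-V})`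
  (Salmhofer 1999, (2.105)) and `effAction_add` —
  `𝒢_eff(·, C₁ + C₂, V) = 𝒢_eff(·, C₁, 𝒢_eff(·, C₂, V))` (loc. cit. (2.106), "the semigroup
  property of the effective actions"), `effAction_zero_cov` (`C = 0`: nothing integrated,
  `𝒢 = V`);
* (kernels `F_m(X₁,…,X_m)` and their norms are in `GrassmannKernels.lean`).

## Sources

M. Salmhofer, *Renormalization: An Introduction* (Springer 1999): Def. 2.19, (2.102)–(2.106)
(PDF pp. 44–45 of the held copy), §4.2.5 (4.72), §4.3 (4.83)–(4.95), Prop. 4.3 (PDF pp. 113,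
118–120); bib key `Salmhofer1999`.  M. Salmhofer, Commun. Math. Phys. 194 (1998) 249, §3
(arXiv:cond-mat/9706188 pp. 11–12 of the held text); bib key `Salmhofer1998`.  G. Benfatto,
A. Giuliani, V. Mastropietro, Ann. Henri Poincaré 7 (2006) 809, §2.2 (2.12)–(2.15); bib key
`BenfattoGiulianiMastropietro2006`.  N. Bourbaki, *Lie Groups and Lie Algebras* Ch. II §6 no. 1
(exp/log of nilpotents), via the tree's `RingTheory.PowerSeries.NilpotentLog.exp_logSum`
(base module `Literature/RingTheory/PowerSeries/NilpotentExpLog`, Mathlib-only imports).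

## Design / what is NOT here

* Only `[Fintype Γ]` (and `[DecidableEq Γ]` for kernels) — no linear order; the monomial basis
  is used only inside proofs.  `R` is any commutative `ℚ`-algebra (`ℂ` in the application).
* `effAction` uses `Ring.inverse Z` (junk `0` when `Z = ∫ dμ_C e^{-V}` is not a unit; then
  `effAction = 0`); the semigroup statement `effAction_add` assumes the intermediate `Z` is a
  unit, `effBoltzmann_add` assumes nothing.
* Not here: the identification of `e^{Δ_C}` with a two-field Berezin integral (Salmhofer's
  Prop. 4.3 is taken as the definition, see `GrassmannLaplacian.lean`), Feynman-graph
  expansions, the RG differential equation (4.89), kernels and norms (`GrassmannKernels.lean`).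
-/

noncomputable section

namespace Literature.MathematicalPhysics.QuantumLattice

open GrassmannAlgebra

/-! ### The constant part and nilpotency of field polynomials -/

section ConstPart

variable (R : Type*) [CommRing R] {Γ : Type*}

/-- The **constant part** (field-independent term) of an element of the Grassmann algebra: the
algebra homomorphism `𝒜 → R` killing every generator (Mathlib's `ExteriorAlgebra.algebraMapInv`);
on `F = Σ_m Σ_X F_m(X) ψ(X₁)⋯ψ(X_m)` it returns `F_0` (Salmhofer 1998, (3.12), the `m = 0`
term; evaluation "at `ψ = 0`"). [folklore] -/
abbrev constPart : GrassmannAlgebra R Γ →ₐ[R] R := ExteriorAlgebra.algebraMapInv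

/-- The constant part of a scalar. [folklore] -/
@[simp] theorem constPart_algebraMap (r : R) :
    constPart R (algebraMap R (GrassmannAlgebra R Γ) r) = r :=
  ExteriorAlgebra.algebraMap_leftInverse _ r

/-- Degree-one elements have no constant part. [folklore] -/
@[simp] theorem constPart_ι (v : Γ → R) : constPart R (ExteriorAlgebra.ι R v) = 0 := by
  simp [ExteriorAlgebra.algebraMapInv]

/-- Generators have no constant part. [folklore] -/
@[simp] theorem constPart_gen [DecidableEq Γ] (X : Γ) : constPart R (gen R X) = 0 :=
  constPart_ι R _

/-- The constant part of a basis monomial `θ_s` is `[s = ∅]`. [folklore] -/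
theorem constPart_grassmannBasis [LinearOrder Γ] [Fintype Γ] (s : Finset Γ) :
    constPart R (grassmannBasis R Γ s) = if s = ∅ then 1 else 0 := by
  rw [grassmannBasis_eq_prod_map_gen, map_list_prod, List.map_map]
  by_cases hs : s = ∅
  · subst hs; simp
  · rw [if_neg hs]
    obtain ⟨a, ha⟩ := Finset.nonempty_iff_ne_empty.2 hs
    exact List.prod_eq_zero (List.mem_map.2 ⟨a, (Finset.mem_sort _).2 ha, by simp⟩)

/-- **The constant part is the coefficient of the empty monomial** `θ_∅ = 1` in the monomial
basis (so it agrees with `scalarPart` of `GrassmannTruncatedExpectation.lean`). [folklore] -/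
theorem constPart_eq_coord_empty [LinearOrder Γ] [Fintype Γ] (a : GrassmannAlgebra R Γ) :
    constPart R a = (grassmannBasis R Γ).coord ∅ a := by
  suffices h : (constPart R (Γ := Γ)).toLinearMap = (grassmannBasis R Γ).coord ∅ from
    LinearMap.congr_fun h a
  refine (grassmannBasis R Γ).ext fun s => ?_
  rw [AlgHom.toLinearMap_apply, constPart_grassmannBasis, Module.Basis.coord_apply,
    Module.Basis.repr_self, Finsupp.single_apply]

namespace GrassmannAlgebra

variable [LinearOrder Γ] [Fintype Γ]

/-- The span of the monomials `θ_s` of degree `|s| ≥ k`. [folklore] -/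
def degGE (k : ℕ) : Submodule R (GrassmannAlgebra R Γ) :=
  Submodule.span R ((grassmannBasis R Γ) '' {s | k ≤ s.card})

/-- Monomials of degree `≥ k` lie in `degGE k`. [folklore] -/
theorem grassmannBasis_mem_degGE {k : ℕ} {s : Finset Γ} (h : k ≤ s.card) :
    grassmannBasis R Γ s ∈ degGE R k :=
  Submodule.subset_span ⟨s, h, rfl⟩

/-- `degGE j · degGE k ⊆ degGE (j + k)` (disjoint supports add degrees, overlapping ones multiply to
zero). [folklore] -/
theorem mul_mem_degGE {j k : ℕ} {a b : GrassmannAlgebra R Γ} (ha : a ∈ degGE R j)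
    (hb : b ∈ degGE R k) : a * b ∈ degGE R (j + k) := by
  induction ha using Submodule.span_induction with
  | mem x hx =>
    obtain ⟨s, hs, rfl⟩ := hx
    induction hb using Submodule.span_induction with
    | mem y hy =>
      obtain ⟨t, ht, rfl⟩ := hy
      by_cases hst : Disjoint s t
      · rw [grassmannBasis_mul_grassmannBasis_of_disjoint R hst]
        refine Submodule.smul_mem _ _ (grassmannBasis_mem_degGE R ?_)
        rw [Finset.card_union_of_disjoint hst]
        exact Nat.add_le_add hs ht
      · rw [grassmannBasis_mul_grassmannBasis_of_not_disjoint R hst]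
        exact Submodule.zero_mem _
    | zero => rw [mul_zero]; exact Submodule.zero_mem _
    | add y z _ _ hy hz => rw [mul_add]; exact Submodule.add_mem _ hy hz
    | smul r y _ hy => rw [mul_smul_comm]; exact Submodule.smul_mem _ r hy
  | zero => rw [zero_mul]; exact Submodule.zero_mem _
  | add x y _ _ hx hy => rw [add_mul]; exact Submodule.add_mem _ hx hy
  | smul r x _ hx => rw [smul_mul_assoc]; exact Submodule.smul_mem _ r hx

/-- Powers of an element of positive degree. [folklore] -/
theorem pow_mem_degGE {a : GrassmannAlgebra R Γ} (ha : a ∈ degGE R 1) (k : ℕ) :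
    a ^ k ∈ degGE R k := by
  induction k with
  | zero =>
    rw [pow_zero, ← grassmannBasis_empty R (ι := Γ)]
    exact grassmannBasis_mem_degGE R (by simp)
  | succ k ih => rw [pow_succ]; exact mul_mem_degGE R ih ha

/-- There are no monomials of degree `> |Γ|`. [folklore] -/
theorem degGE_eq_bot {k : ℕ} (hk : Fintype.card Γ < k) : degGE R (Γ := Γ) k = ⊥ := by
  rw [degGE, Submodule.span_eq_bot]
  rintro _ ⟨s, hs, rfl⟩
  exact absurd (lt_of_lt_of_le hk hs) (not_lt.2 (Finset.card_le_univ s))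

/-- An element whose empty-monomial coefficient vanishes has positive degree. [folklore] -/
theorem mem_degGE_one_of_coord_empty {a : GrassmannAlgebra R Γ}
    (h : (grassmannBasis R Γ).coord ∅ a = 0) : a ∈ degGE R 1 := by
  rw [← (grassmannBasis R Γ).sum_repr a]
  refine Submodule.sum_mem _ fun s _ => ?_
  by_cases hs : s = ∅
  · subst hs
    rw [show (grassmannBasis R Γ).repr a ∅ = 0 from h, zero_smul]
    exact Submodule.zero_mem _
  · exact Submodule.smul_mem _ _ (grassmannBasis_mem_degGE R
      (Finset.one_le_card.2 (Finset.nonempty_iff_ne_empty.2 hs)))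

/-- **An element without constant term satisfies `a ^ (|Γ| + 1) = 0`.** [folklore] -/
theorem pow_card_succ_eq_zero_of_coord_empty {a : GrassmannAlgebra R Γ}
    (h : (grassmannBasis R Γ).coord ∅ a = 0) : a ^ (Fintype.card Γ + 1) = 0 := by
  have := pow_mem_degGE R (mem_degGE_one_of_coord_empty R h) (Fintype.card Γ + 1)
  rwa [degGE_eq_bot R (Nat.lt_succ_self _), Submodule.mem_bot] at this

end GrassmannAlgebra

/-- **Field polynomials without constant part are nilpotent**: `constPart a = 0` implies
`a ^ (|Γ| + 1) = 0` (an element of positive degree raised beyond the number of generators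
vanishes; Berezin 1966, Ch. I §3). [folklore] -/
theorem pow_card_succ_eq_zero_of_constPart_eq_zero [Fintype Γ] {a : GrassmannAlgebra R Γ}
    (h : constPart R a = 0) : a ^ (Fintype.card Γ + 1) = 0 := by
  letI : LinearOrder Γ := LinearOrder.lift' (Fintype.equivFin Γ) (Fintype.equivFin Γ).injective
  exact GrassmannAlgebra.pow_card_succ_eq_zero_of_coord_empty R (by rwa [← constPart_eq_coord_empty])

/-- **Field polynomials without constant part are nilpotent.** [folklore] -/
theorem isNilpotent_of_constPart_eq_zero [Fintype Γ] {a : GrassmannAlgebra R Γ}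
    (h : constPart R a = 0) : IsNilpotent a :=
  ⟨_, pow_card_succ_eq_zero_of_constPart_eq_zero R h⟩

end ConstPart

/-! ### The truncated logarithm -/

section Log

variable (R : Type*) [CommRing R] [Algebra ℚ R] {Γ : Type*}

/-- The **logarithm of `1 + x`** on the Grassmann algebra: the series
`log (1 + x) = Σ_{k ≥ 1} (-1)^{k+1} x^k / k`, truncated at the nilpotency class of `x` (a finite
sum giving the full series for nilpotent `x`, i.e. for `x` without constant part; junk `0` for
non-nilpotent `x`, where `nilpotencyClass x = 0`).  Companion of the tree's
`grassmannExp = IsNilpotent.exp` (Salmhofer 1999, (4.85): `𝒢 = log ∫ dμ_C …`). [folklore] -/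
def grassmannLog1p (x : GrassmannAlgebra R Γ) : GrassmannAlgebra R Γ :=
  ∑ k ∈ Finset.range (nilpotencyClass x), (((-1 : ℚ) ^ (k + 1)) / k) • x ^ k

/-- The truncation level is immaterial beyond the nilpotency class: for `x ^ m = 0` the
logarithm is the sum over `k < m`. [folklore] -/
theorem grassmannLog1p_eq_sum {x : GrassmannAlgebra R Γ} {m : ℕ} (hm : x ^ m = 0) :
    grassmannLog1p R x = ∑ k ∈ Finset.range m, (((-1 : ℚ) ^ (k + 1)) / k) • x ^ k := by
  have hle : nilpotencyClass x ≤ m := csInf_le' hm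
  rw [grassmannLog1p, ← Finset.sum_range_add_sum_Ico _ hle, left_eq_add]
  refine Finset.sum_eq_zero fun k hk => ?_
  rw [pow_eq_zero_of_le (Finset.mem_Ico.1 hk).1 (pow_nilpotencyClass ⟨m, hm⟩), smul_zero]

/-- `log 1 = 0`. [folklore] -/
@[simp] theorem grassmannLog1p_zero : grassmannLog1p R (0 : GrassmannAlgebra R Γ) = 0 := by
  rw [grassmannLog1p_eq_sum R (m := 1) (by simp)]
  simp

/-- **`exp (log (1 + x)) = 1 + x`** for nilpotent `x` (Bourbaki, Lie II §6 no. 1; the tree's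
`NilpotentLog.exp_logSum`). [folklore] -/
theorem grassmannExp_grassmannLog1p {x : GrassmannAlgebra R Γ} (hx : IsNilpotent x) :
    grassmannExp (grassmannLog1p R x) = 1 + x := by
  rw [grassmannExp, grassmannLog1p]
  exact RingTheory.PowerSeries.NilpotentLog.exp_logSum (pow_nilpotencyClass hx)

/-- **`log (exp y) = y`** for nilpotent `y` (Bourbaki, Lie II §6 no. 1; the tree's
`NilpotentLog.logSum_exp_sub_one`). [folklore] -/
theorem grassmannLog1p_grassmannExp_sub_one {y : GrassmannAlgebra R Γ} (hy : IsNilpotent y) :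
    grassmannLog1p R (grassmannExp y - 1) = y := by
  set m := max (nilpotencyClass y) (nilpotencyClass (grassmannExp y - 1)) with hm
  have hym : y ^ m = 0 := pow_eq_zero_of_le (le_max_left _ _) (pow_nilpotencyClass hy)
  have hem : (grassmannExp y - 1) ^ m = 0 :=
    pow_eq_zero_of_le (le_max_right _ _) (pow_nilpotencyClass (IsNilpotent.isNilpotent_exp_sub_one hy))
  rw [grassmannLog1p_eq_sum R hem, grassmannExp]
  exact RingTheory.PowerSeries.NilpotentLog.logSum_exp_sub_one hym

/-- The logarithm is nilpotent (it has no constant term). [folklore] -/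
theorem isNilpotent_grassmannLog1p (x : GrassmannAlgebra R Γ) : IsNilpotent (grassmannLog1p R x) := by
  by_cases hx : IsNilpotent x
  · exact ⟨_, RingTheory.PowerSeries.NilpotentLog.logSum_pow_eq_zero (pow_nilpotencyClass hx)⟩
  · rw [grassmannLog1p, nilpotencyClass, Nat.sInf_eq_zero.2 (Or.inr ?_), Finset.range_zero,
      Finset.sum_empty]
    · exact IsNilpotent.zero
    · ext k; exact ⟨fun hk => hx ⟨k, hk⟩, fun h => h.elim⟩

end Log

/-! ### Gaussian expectation, effective Boltzmann factor and effective action -/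

section EffectiveAction

variable (R : Type*) [CommRing R] [Algebra ℚ R] {Γ : Type*} [Fintype Γ]

/-- The **Grassmann Gaussian expectation** `F ↦ ∫ dμ_C(ψ) F(ψ)`: the constant part of the
convolution `μ_C ⋆ F` (evaluation of `∫ dμ_C(χ) F(χ + ψ)` at `ψ = 0`; Salmhofer 1999, (4.84),
(4.88)).  Normalised: `gaussExpect_one`. [cite: Salmhofer1999, §4.3.1 (4.84)] -/
def gaussExpect (C : Matrix Γ Γ R) : GrassmannAlgebra R Γ →ₗ[R] R :=
  (constPart R).toLinearMap ∘ₗ gaussConv R C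

/-- Unfolding `gaussExpect`. [folklore] -/
theorem gaussExpect_apply (C : Matrix Γ Γ R) (F : GrassmannAlgebra R Γ) :
    gaussExpect R C F = constPart R (gaussConv R C F) := rfl

/-- The Gaussian measure is normalised: `∫ dμ_C 1 = 1` (Salmhofer 1999, after (4.84)). [folklore] -/
@[simp] theorem gaussExpect_one (C : Matrix Γ Γ R) : gaussExpect R C 1 = 1 := by
  rw [gaussExpect_apply, gaussConv_one, map_one]

/-- The two-point function: `∫ dμ_C ψ(X)ψ(Y) = ½ (C(Y,X) - C(X,Y))` (`= -C(X,Y)` for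
antisymmetric `C`; see `gaussConv_gen_mul_gen`). [folklore] -/
theorem gaussExpect_gen_mul_gen [DecidableEq Γ] (C : Matrix Γ Γ R) (X Y : Γ) :
    gaussExpect R C (gen R X * gen R Y) = ((1 / 2 : ℚ) • (1 : R)) * (C Y X - C X Y) := by
  rw [gaussExpect_apply, gaussConv_gen_mul_gen, map_add, map_mul, constPart_gen, zero_mul, zero_add,
    constPart_algebraMap]

/-- The **effective Boltzmann factor** `μ_C ⋆ e^{-V} = e^{Δ_C} e^{-V}`: Salmhofer's `e^{𝒢(t,ψ)}`
((4.88) with `𝒢(0,ψ) = -V(ψ)`), i.e. `∫ dμ_C(χ) e^{-V(χ+ψ)}` (Def. 2.19 (2.102), (4.85)).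
[cite: Salmhofer1999, Prop. 4.3 (4.88)] -/
def effBoltzmann (C : Matrix Γ Γ R) (V : GrassmannAlgebra R Γ) : GrassmannAlgebra R Γ :=
  gaussConv R C (grassmannExp (-V))

/-- The **normalised partition function** `Z = ∫ dμ_C e^{-V}`, the constant part of the effective
Boltzmann factor (Salmhofer 1998, §2.4 `Z̃_Λ = ∫ dμ_C e^{-λS₄}`; BGM 2006, (2.6)). [folklore] -/
def effPartitionFn (C : Matrix Γ Γ R) (V : GrassmannAlgebra R Γ) : R :=
  constPart R (effBoltzmann R C V)

/-- The **Wilsonian effective action** of the interaction `V` after integrating out a Gaussian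
field of covariance `C`, normalised to vanishing constant part:
`effAction C V = -log (Z⁻¹ ∫ dμ_C(χ) e^{-V(χ + ψ)})`, `Z = ∫ dμ_C e^{-V}` (Salmhofer 1999,
Def. 2.19 (2.102) and (4.72)/(4.85) for fermions, where `𝒢 = log ∫ dμ_C(χ) e^{𝒢(0,χ+ψ)}` keeps the
constant; BGM 2006, (2.13): `e^{-L²βF₀} ∫P(dψ^{≤0}) e^{-𝒱^{(0)}}`, `𝒱^{(0)}(0) = 0`).  `Z⁻¹` is
`Ring.inverse` (junk `0`, hence `effAction = 0`, when `Z` is not a unit). [cite: Salmhofer1999, Def. 2.19 (2.102)] -/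
def effAction (C : Matrix Γ Γ R) (V : GrassmannAlgebra R Γ) : GrassmannAlgebra R Γ :=
  -grassmannLog1p R (Ring.inverse (effPartitionFn R C V) • effBoltzmann R C V - 1)

variable (C C₁ C₂ : Matrix Γ Γ R) (V : GrassmannAlgebra R Γ)

/-- Unfolding `effBoltzmann`. [folklore] -/
theorem effBoltzmann_def : effBoltzmann R C V = gaussConv R C (grassmannExp (-V)) := rfl

/-- Unfolding `effPartitionFn`: `Z = ∫ dμ_C e^{-V}`. [folklore] -/
theorem effPartitionFn_eq_gaussExpect : effPartitionFn R C V = gaussExpect R C (grassmannExp (-V)) := rfl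

/-- Unfolding `effAction`. [folklore] -/
theorem effAction_def : effAction R C V =
    -grassmannLog1p R (Ring.inverse (effPartitionFn R C V) • effBoltzmann R C V - 1) := rfl

/-- Nothing to integrate: `μ_0 ⋆ e^{-V} = e^{-V}`. [folklore] -/
@[simp] theorem effBoltzmann_zero_cov : effBoltzmann R 0 V = grassmannExp (-V) := by
  rw [effBoltzmann, gaussConv_zero, Module.End.one_apply]

/-- **Semigroup property of the effective Boltzmann factors** (Salmhofer 1999, (2.105):
`e^{𝒢_eff(ψ,C₁+C₂,V)} = ∫ dμ_{C₁}(φ) e^{𝒢_eff(φ+ψ,C₂,V)}`, with the roles of `C₁, C₂` as in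
`gaussConv_add`): `μ_{C₁+C₂} ⋆ e^{-V} = μ_{C₁} ⋆ (μ_{C₂} ⋆ e^{-V})`. [cite: Salmhofer1999, §2.5.1 (2.105)] -/
theorem effBoltzmann_add : effBoltzmann R (C₁ + C₂) V = gaussConv R C₁ (effBoltzmann R C₂ V) := by
  rw [effBoltzmann, gaussConv_add_apply, effBoltzmann]

/-- The effective action has no constant part (when `Z` is a unit). [folklore] -/
theorem constPart_effAction (hZ : IsUnit (effPartitionFn R C V)) : constPart R (effAction R C V) = 0 := by
  have h0 : constPart R (Ring.inverse (effPartitionFn R C V) • effBoltzmann R C V - 1) = 0 := by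
    rw [map_sub, map_smul, map_one, smul_eq_mul, ← effPartitionFn, Ring.inverse_mul_cancel _ hZ, sub_self]
  rw [effAction, map_neg, grassmannLog1p, map_sum, neg_eq_zero]
  refine Finset.sum_eq_zero fun k _ => ?_
  rw [map_rat_smul (constPart R (Γ := Γ)), map_pow, h0]
  rcases k with _ | k
  · simp
  · rw [zero_pow (Nat.succ_ne_zero k), smul_zero]

/-- **`μ_C ⋆ e^{-V} = Z · e^{-effAction}`**: the effective Boltzmann factor is the exponential
of minus the effective action, up to the constant `Z` (Salmhofer 1999, (4.85)/(4.88); requires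
`Z` to be a unit). [cite: Salmhofer1999, §4.3.1 (4.85)] -/
theorem effBoltzmann_eq_smul_grassmannExp (hZ : IsUnit (effPartitionFn R C V)) :
    effBoltzmann R C V = effPartitionFn R C V • grassmannExp (-effAction R C V) := by
  have h0 : constPart R (Ring.inverse (effPartitionFn R C V) • effBoltzmann R C V - 1) = 0 := by
    rw [map_sub, map_smul, map_one, smul_eq_mul, ← effPartitionFn, Ring.inverse_mul_cancel _ hZ, sub_self]
  rw [effAction, neg_neg, grassmannExp_grassmannLog1p R (isNilpotent_of_constPart_eq_zero R h0),
    add_sub_cancel, smul_smul, Ring.mul_inverse_cancel _ hZ, one_smul]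

/-- **Initial condition**: with nothing integrated out the effective action is the interaction,
`effAction 0 V = V`, for `V` without constant part (Salmhofer 1999, (4.85) at `t = 0`,
`𝒢(0,ψ) = λV(ψ)`). [folklore] -/
theorem effAction_zero_cov (hV : constPart R V = 0) : effAction R 0 V = V := by
  have hn : IsNilpotent (-V) := isNilpotent_of_constPart_eq_zero R (by rw [map_neg, hV, neg_zero])
  have hZ : effPartitionFn R 0 V = 1 := by
    rw [effPartitionFn, effBoltzmann_zero_cov, grassmannExp, IsNilpotent.map_exp hn, map_neg, hV,
      neg_zero, IsNilpotent.exp_zero]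
  rw [effAction, hZ, Ring.inverse_one, one_smul, effBoltzmann_zero_cov,
    grassmannLog1p_grassmannExp_sub_one R hn, neg_neg]

/-- **The semigroup property of the effective actions** (Salmhofer 1999, (2.106):
`𝒢_eff(ψ, C₁ + C₂, -λV) = 𝒢_eff(ψ, C₂, 𝒢_eff(·, C₁, -λV))`, here with the convolution order of
`gaussConv_add` and in the normalised convention): integrating out covariance `C₂` and then
`C₁` is integrating out `C₁ + C₂`.  Requires the intermediate partition function to be a unit.
[cite: Salmhofer1999, §2.5.1 (2.106)] -/
theorem effAction_add (hZ₂ : IsUnit (effPartitionFn R C₂ V)) :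
    effAction R (C₁ + C₂) V = effAction R C₁ (effAction R C₂ V) := by
  obtain ⟨u, hu⟩ := hZ₂
  -- the Boltzmann factor of the intermediate effective action
  have hB : effBoltzmann R C₁ (effAction R C₂ V) = Ring.inverse (effPartitionFn R C₂ V) •
      effBoltzmann R (C₁ + C₂) V := by
    rw [effBoltzmann, show grassmannExp (-effAction R C₂ V) =
        Ring.inverse (effPartitionFn R C₂ V) • effBoltzmann R C₂ V from ?_, map_smul, ← effBoltzmann_add]
    have h := effBoltzmann_eq_smul_grassmannExp R C₂ V ⟨u, hu⟩
    rw [h, smul_smul, Ring.inverse_mul_cancel _ ⟨u, hu⟩, one_smul]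
  have hZ : effPartitionFn R C₁ (effAction R C₂ V) =
      Ring.inverse (effPartitionFn R C₂ V) * effPartitionFn R (C₁ + C₂) V := by
    rw [effPartitionFn, hB, map_smul, smul_eq_mul]
    rfl
  rw [effAction_def R C₁, hZ, hB, smul_smul, Ring.mul_inverse_rev, ← hu, Ring.inverse_unit,
    Ring.inverse_unit, inv_inv, mul_assoc, Units.mul_inv, mul_one, ← effAction_def]

end EffectiveAction


end Literature.MathematicalPhysics.QuantumLattice
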